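import Summits.ResolutionOfSingularities.ResolutionOfSingularities.Theorems.EigenLadderLU4
import HarnessLib

/-!
# EigenLadderLU (5) — PART D (Kummer law), PART E (tame Kummer cell, located residual `R24`, cut,
`closes_kummer`), PART E2 (the cell and the datum from a bare `σ`-stable chart)

[WRITER NOTE (decomp-res writer g12): the gate caps Theorems files with proofs at 400 lines, so the
lens's tree file `EigenLadderLU5.lean` (469 l, sha256 08b5d2d1…) is landed as TWO modules split at a
namespace-block boundary — `EigenLadderLU5` (PART D Kummer law + PART E tame Kummer cell, cut mod D,
`closes_kummer`) and `EigenLadderLU5B` (PART E2 bare `σ`-stable chart) — content VERBATIM (plus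
bookkeeping docstrings on undocumented simp lemmas); the node's import chain becomes EigenLadderLU →
EigenLadderLU1B → EigenLadderLU2 → EigenLadderLU2B → EigenLadderLU3 → EigenLadderLU4 →
EigenLadderLU5 → EigenLadderLU5B → EigenLadderLU6 (one namespace `…Theorems.EigenLadderLU`
throughout).]
-/

namespace Summit.ResolutionOfSingularities.ResolutionOfSingularities.Theorems.EigenLadderLU

open Polynomial
open Literature.AlgebraicGeometry.Resolution
open Summit.ResolutionOfSingularities.ResolutionOfSingularities.Theorems
open Summit.ResolutionOfSingularities.ResolutionOfSingularities.Theorems.AdaptedChartHensel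
open Summit.ResolutionOfSingularities.ResolutionOfSingularities.Theorems.GaloisDescentLU
open Summit.ResolutionOfSingularities.ResolutionOfSingularities.Theorems.KeyChainLU

/-! ## PART D — THE KUMMER LAW (K-e″, decided modulo THEOREM D) as the corollary `t = (1,0,0,0)` of
the diagonal law (PART F) -/

section Law

variable {k : Type} [Field k] {K : Type} [Field K] [Algebra k K]

/-- **(K-e″) LAW-E — THE DATUM-PRODUCING LAW (tame coming-down from an upstairs chart), decided
modulo THEOREM D.**  Let `K' ⊇ K` be finite Galois with CYCLIC group `⟨σ⟩` of exponent `ℓ`,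
`(ℓ : k) ≠ 0`, `μ_ℓ ⊆ k` (`ζ` a primitive `ℓ`-th root of unity), `O' ∣ O` a `σ`-stable (`G = G_Z`)
residually rational prolongation, and let `(A, x₀, …, x₃)` be a VALUE-ADAPTED REGULAR CHART of
`(K', v')` (THEOREM H's hypothesis, verbatim clauses) which is KUMMER for `σ`: `σ x₀ = ζ x₀` and
`σ xⱼ = xⱼ` (`j = 1, 2, 3`).  Then `O` carries a `GaloisHenselDescentDatum k O` (g23's typed input):
the UPSTAIRS frame `F' = k(x)` is `G`-stable with Hensel generator `η'` (THEOREM H's standard-étale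
neighbourhood, `henselDatum_of_standardEtalePresentation`), and the DOWNSTAIRS sub-top is the field of
`σ`-invariants `F' ∩ K = F'^σ = k(x₀^ℓ, x₁, x₂, x₃)` (PART C: invariants of a diagonal tame action lie
in the field of invariant monomials, `mem_of_fixed`), which is monomially rational, hence key-chain by
THEOREM D; `[K : F₁] < ∞` and `K | F₁` separable because `K' = F₁(x₀, η')` with `x₀^ℓ ∈ F₁`, `ℓ ≠ 0`
and `η'` a simple root.  No frame downstairs is GIVEN: it is COMPUTED as the invariant monomials of the
upstairs chart. [CossartPiltant2008, Prop. 6.2, Thm. 6.5] [Grothendieck1967, Prop. 18.4.6 (ii)]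
[KnafKuhlmann2005 = arXiv:math/0304201, Thm. 1.1] [folklore] -/
theorem galoisHenselDescentDatum_of_kummerChart (hD : TheoremD k) (O : ValuationSubring K)
    (hr : Nonempty O.valuation.RankOne)
    (K' : IntermediateField K (AlgebraicClosure K)) [FiniteDimensional K K'] [IsGalois K K']
    (σ : K' ≃ₐ[K] K') (hcyc : ∀ g : K' ≃ₐ[K] K', ∃ i : ℕ, g = σ ^ i)
    {ℓ : ℕ} (hℓ : 0 < ℓ) (hℓk : (ℓ : k) ≠ 0) {ζ : k} (hζ : IsPrimitiveRoot ζ ℓ)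
    (O' : ValuationSubring K') (hO'O : O'.comap (algebraMap K K') = O)
    (hσO' : ∀ y : K', y ∈ O' ↔ σ y ∈ O')
    (hκ' : ∀ y ∈ O', ∃ c : k, y - algebraMap k K' c ∈ O'.nonunits)
    (A : Subalgebra k K') (hAO : A.toSubring ≤ O'.toSubring) (x : Fin 4 → K') (hx : ∀ i, x i ∈ A)
    (hAfg : A.FG) (hfrac : IsFractionRing A K')
    (hreg : IsRegularLocalRing (Localization.AtPrime (centreIdeal A O' hAO)))
    (hdim : ringKrullDim (Localization.AtPrime (centreIdeal A O' hAO)) = 4)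
    (hmax : IsLocalRing.maximalIdeal (Localization.AtPrime (centreIdeal A O' hAO)) =
      Ideal.span (Set.range fun i =>
        algebraMap A (Localization.AtPrime (centreIdeal A O' hAO)) ⟨x i, hx i⟩))
    (hind : ∀ m : Fin 3 → ℤ, (∏ i : Fin 3, O'.valuation (x (Fin.castSucc i)) ^ m i) = 1 → m = 0)
    (hspan : ∀ z : K', z ≠ 0 → ∃ E : ℕ, 0 < E ∧ ∃ m : Fin 3 → ℤ,
      O'.valuation z ^ E = ∏ i : Fin 3, O'.valuation (x (Fin.castSucc i)) ^ m i)
    (hx0σ : σ (x 0) = algebraMap k K' ζ * x 0) (hxfix : ∀ i : Fin 3, σ (x i.succ) = x i.succ) :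
    GaloisHenselDescentDatum k O :=
  galoisHenselDescentDatum_of_diagonalChart hD O hr K' σ hcyc hℓ hℓk hζ O' hO'O hσO' hκ' A hAO x hx hAfg
    hfrac hreg hdim hmax hind hspan (fun j => if j = 0 then 1 else 0) (if_pos rfl) fun j => by
      by_cases hj : j = 0
      · subst hj
        rw [if_pos rfl, pow_one, hx0σ]
      · obtain ⟨i, rfl⟩ : ∃ i : Fin 3, j = i.succ := ⟨j.pred hj, (Fin.succ_pred j hj).symm⟩
        rw [if_neg hj, pow_zero, map_one, one_mul, hxfix]

end Law

end Summit.ResolutionOfSingularities.ResolutionOfSingularities.Theorems.EigenLadderLU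

namespace Summit.ResolutionOfSingularities.ResolutionOfSingularities.Theorems.EigenLadderLU

open Polynomial
open Literature.AlgebraicGeometry.Resolution
open Summit.ResolutionOfSingularities.ResolutionOfSingularities.Theses
open Summit.ResolutionOfSingularities.ResolutionOfSingularities.Theorems
open Summit.ResolutionOfSingularities.ResolutionOfSingularities.Theorems.AdaptedChartHensel
open Summit.ResolutionOfSingularities.ResolutionOfSingularities.Theorems.GaloisDescentLU
open Summit.ResolutionOfSingularities.ResolutionOfSingularities.Theorems.KeyChainLU
open Summit.ResolutionOfSingularities.ResolutionOfSingularities.Theorems.HenselKeyChainLU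
open Summit.ResolutionOfSingularities.ResolutionOfSingularities.Theorems.PfaffLine
open Summit.ResolutionOfSingularities.ResolutionOfSingularities.Theorems.ToricLadder
open Summit.ResolutionOfSingularities.ResolutionOfSingularities.Theorems.KaplanskyLadder
open Summit.ResolutionOfSingularities.ResolutionOfSingularities.Theorems.PerronLadder
open Summit.ResolutionOfSingularities.ResolutionOfSingularities.Theorems.DefectlessLadder
open Summit.ResolutionOfSingularities.ResolutionOfSingularities.Theorems.WCut

/-! ## PART E — the TAME KUMMER CELL, the law on the cell, the located residual R24, the cut (mod D) and
ROOT BY NAME -/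

section Cell

variable {k : Type} [Field k] {K : Type} [Field K] [Algebra k K]

/-- **CELL `C24` — TAME KUMMER CHART BELOW `O`** (tag INSTRUMENTABLE: every clause is a first-order /
finite-type condition on a finite Galois extension and a finitely generated algebra).  There is a finite
Galois extension `K' ⊇ K` with CYCLIC group `⟨σ⟩` of exponent `ℓ` prime to the characteristic exponent of
`k` (`(ℓ : k) ≠ 0`), `μ_ℓ ⊆ k`, a `σ`-stable (`G = G_Z`), residually `k`-rational prolongation `O' ∣ O`,
and UPSTAIRS a value-adapted regular chart `(A, x₀, …, x₃)` of `(K', v')` (THEOREM H's hypothesis,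
verbatim) which is KUMMER for `σ`: `σ x₀ = ζ x₀`, `σ xⱼ = xⱼ` (`j ≥ 1`).  In words: LU holds upstairs
in a chart three of whose parameters are `K`-rational and whose fourth spans the radical direction of the
tame cyclic cover. -/
def TameKummerChartBelow (k : Type) [Field k] {K : Type} [Field K] [Algebra k K]
    (O : ValuationSubring K) : Prop :=
  ∃ K' : IntermediateField K (AlgebraicClosure K), FiniteDimensional K K' ∧ IsGalois K K' ∧
  ∃ σ : K' ≃ₐ[K] K', (∀ g : K' ≃ₐ[K] K', ∃ i : ℕ, g = σ ^ i) ∧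
  ∃ ℓ : ℕ, 0 < ℓ ∧ (ℓ : k) ≠ 0 ∧ ∃ ζ : k, IsPrimitiveRoot ζ ℓ ∧
  ∃ O' : ValuationSubring K', O'.comap (algebraMap K K') = O ∧ (∀ y : K', y ∈ O' ↔ σ y ∈ O') ∧
    (∀ y ∈ O', ∃ c : k, y - algebraMap k K' c ∈ O'.nonunits) ∧
  ∃ (A : Subalgebra k K') (hAO : A.toSubring ≤ O'.toSubring) (x : Fin 4 → K') (hx : ∀ i, x i ∈ A),
    A.FG ∧ IsFractionRing A K' ∧
    IsRegularLocalRing (Localization.AtPrime (centreIdeal A O' hAO)) ∧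
    ringKrullDim (Localization.AtPrime (centreIdeal A O' hAO)) = 4 ∧
    IsLocalRing.maximalIdeal (Localization.AtPrime (centreIdeal A O' hAO)) =
      Ideal.span (Set.range fun i =>
        algebraMap A (Localization.AtPrime (centreIdeal A O' hAO)) ⟨x i, hx i⟩) ∧
    (∀ m : Fin 3 → ℤ, (∏ i : Fin 3, O'.valuation (x (Fin.castSucc i)) ^ m i) = 1 → m = 0) ∧
    (∀ z : K', z ≠ 0 → ∃ E : ℕ, 0 < E ∧ ∃ m : Fin 3 → ℤ,
      O'.valuation z ^ E = ∏ i : Fin 3, O'.valuation (x (Fin.castSucc i)) ^ m i) ∧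
    σ (x 0) = algebraMap k K' ζ * x 0 ∧ ∀ i : Fin 3, σ (x i.succ) = x i.succ

/-- **LAW ON THE CELL (decided modulo THEOREM D)**: a tame Kummer chart below a rank-one `O` yields the
Galois–Hensel descent datum. [folklore] -/
theorem galoisHenselDescentDatum_of_tameKummerChartBelow (hD : TheoremD k) (O : ValuationSubring K)
    (hr : Nonempty O.valuation.RankOne) (h : TameKummerChartBelow k O) :
    GaloisHenselDescentDatum k O := by
  obtain ⟨K', hfin, hgal, σ, hcyc, ℓ, hℓ, hℓk, ζ, hζ, O', hO'O, hσO', hκ', A, hAO, x, hx, hAfg, hfrac,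
    hreg, hdim, hmax, hind, hspan, hx0σ, hxfix⟩ := h
  haveI := hfin
  haveI := hgal
  exact galoisHenselDescentDatum_of_kummerChart hD O hr K' σ hcyc hℓ hℓk hζ O' hO'O hσO' hκ' A hAO x
    hx hAfg hfrac hreg hdim hmax hind hspan hx0σ hxfix

/-- **LAW ON THE CELL, composed with g23 and g22**: mod THEOREM D the tame Kummer cell lies in the Hensel
cell … [folklore] -/
theorem henselKeyChainTopBelow_of_tameKummerChartBelow (hD : TheoremD k) (O : ValuationSubring K)
    (hr : Nonempty O.valuation.RankOne) (h : TameKummerChartBelow k O) :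
    HenselKeyChainTopBelow k O :=
  henselKeyChainTopBelow_of_galoisHenselDescent O
    (galoisHenselDescentDatum_of_tameKummerChartBelow hD O hr h)

/-- … and therefore satisfies relative local uniformization (g22 `relLU_of_henselKeyChainTop`).
[folklore] -/
theorem relLU_of_tameKummerChartBelow (hD : TheoremD k) (O : ValuationSubring K)
    (hr : Nonempty O.valuation.RankOne) (h : TameKummerChartBelow k O) :
    RelLocalUniformization k K O :=
  relLU_of_galoisHenselDescent (galoisHenselDescentDatum_of_tameKummerChartBelow hD O hr h)

/-- Contrapositive rung (mod D): OFF the descent cell there is NO tame Kummer chart. [folklore] -/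
theorem not_tameKummerChartBelow_of_not_datum (hD : TheoremD k) (O : ValuationSubring K)
    (hr : Nonempty O.valuation.RankOne) (h : ¬ GaloisHenselDescentDatum k O) :
    ¬ TameKummerChartBelow k O :=
  fun hc => h (galoisHenselDescentDatum_of_tameKummerChartBelow hD O hr hc)

end Cell

section Cut

/-- **THEOREM D FOR ALL GROUND FIELDS** as one typed piece (tag UNDECIDED · ATTACKABLE = window item
(K-D); it is g21's rank-2 item, used here exactly as g22's `closes_adapted` used it). -/
def TheoremDAll : Prop := ∀ (k : Type) [Field k], TheoremD k

/-- **CELL PIECE `C24`** (tag DECIDED-MOD-D — `nonKHToricArchLUKeyHenselDescentKummerCell_of_theoremD`;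
WEAKER than the root; located at `(e, c, n) = (3, 3, 4)`): the g23 located residual restricted to the
TAME KUMMER CELL. -/
def NonKHToricArchLUKeyHenselDescentKummerCell (e c n : ℕ) : Prop :=
  ∀ p : ℕ, p.Prime → ∀ (k K : Type) [Field k] [CharP k p] [Field K] [Algebra k K],
    Algebra.trdeg k K ≤ n → ∀ O : ValuationSubring K, Nonempty O.valuation.RankOne →
    (∀ y ∈ O, ∃ f : Polynomial k, f ≠ 0 ∧ Polynomial.aeval y f ∈ O.nonunits) →
    ¬ IsAbhyankarPlace O (algebraMap k K).fieldRange ⊤ →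
    ¬ (∃ d : ℕ, d < n ∧ SepDenseBelow k O d) → ¬ ToricDenseBelow k O e → ¬ KHTopBelow k O c →
    ¬ KeyChainTopBelow k O → ¬ HenselKeyChainTopBelow k O → ¬ GaloisHenselDescentDatum k O →
    TameKummerChartBelow k O → RelLocalUniformization k K O

/-- THE LAW DECIDES THE CELL PIECE modulo THEOREM D, for all parameters. [folklore] -/
theorem nonKHToricArchLUKeyHenselDescentKummerCell_of_theoremD (hD : TheoremDAll) (e c n : ℕ) :
    NonKHToricArchLUKeyHenselDescentKummerCell e c n :=
  fun _ _ k _ _ _ _ _ _ O hr _ _ _ _ _ _ _ _ hC => relLU_of_tameKummerChartBelow (hD k) O hr hC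

/-- **NEW LOCATED RESIDUAL `R24`** (tag UNDECIDED · WEAKER than the root · located at
`(e, c, n) = (3, 3, 4)`): the g23 residual OFF the tame Kummer cell as well — places over which NO tame
cyclic cover acquires a Kummer-adapted regular chart. -/
def NonKHToricArchLUKeyHenselDescentKummer (e c n : ℕ) : Prop :=
  ∀ p : ℕ, p.Prime → ∀ (k K : Type) [Field k] [CharP k p] [Field K] [Algebra k K],
    Algebra.trdeg k K ≤ n → ∀ O : ValuationSubring K, Nonempty O.valuation.RankOne →
    (∀ y ∈ O, ∃ f : Polynomial k, f ≠ 0 ∧ Polynomial.aeval y f ∈ O.nonunits) →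
    ¬ IsAbhyankarPlace O (algebraMap k K).fieldRange ⊤ →
    ¬ (∃ d : ℕ, d < n ∧ SepDenseBelow k O d) → ¬ ToricDenseBelow k O e → ¬ KHTopBelow k O c →
    ¬ KeyChainTopBelow k O → ¬ HenselKeyChainTopBelow k O → ¬ GaloisHenselDescentDatum k O →
    ¬ TameKummerChartBelow k O → RelLocalUniformization k K O

/-- Dropping the extra negated hypothesis (hypothesis-free direction of the cut). [folklore] -/
theorem nonKHToricArchLUKeyHenselDescentKummer_of_descent {e c n : ℕ}
    (h : NonKHToricArchLUKeyHenselDescent e c n) : NonKHToricArchLUKeyHenselDescentKummer e c n :=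
  fun p hp k K _ _ _ _ hd O h1 h0 hA hnd hnt hnk hkey hH hδ _ =>
    h p hp k K hd O h1 h0 hA hnd hnt hnk hkey hH hδ

/-- **THE KUMMER CUT** (kernel, exact modulo THEOREM D): the g23 located residual is EQUIVALENT to its
part off the tame Kummer cell — by the law, off the descent cell there is no tame Kummer chart.
[folklore] -/
theorem nonKHToricArchLUKeyHenselDescent_iff_kummer (hD : TheoremDAll) {e c n : ℕ} :
    NonKHToricArchLUKeyHenselDescent e c n ↔ NonKHToricArchLUKeyHenselDescentKummer e c n := by
  refine ⟨nonKHToricArchLUKeyHenselDescentKummer_of_descent,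
    fun h p hp k K _ _ _ _ hd O hr hz hA hnd hnt hnk hkey hH hδ => ?_⟩
  exact h p hp k K hd O hr hz hA hnd hnt hnk hkey hH hδ
    (not_tameKummerChartBelow_of_not_datum (hD k) O hr hδ)

/-- The same cut as a conjunction «cell piece ∧ new residual» (mod D). [folklore] -/
theorem nonKHToricArchLUKeyHenselDescent_iff_cell_and_kummer (hD : TheoremDAll) {e c n : ℕ} :
    NonKHToricArchLUKeyHenselDescent e c n ↔
      NonKHToricArchLUKeyHenselDescentKummerCell e c n ∧ NonKHToricArchLUKeyHenselDescentKummer e c n :=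
  ⟨fun h => ⟨nonKHToricArchLUKeyHenselDescentKummerCell_of_theoremD hD e c n,
      nonKHToricArchLUKeyHenselDescentKummer_of_descent h⟩,
    fun h => (nonKHToricArchLUKeyHenselDescent_iff_kummer hD).2 h.2⟩

/-- The EXACT re-location at the programme's parameters `(3, 3, 4)`. [folklore] -/
theorem nonKHToricArchLUKeyHenselDescent334_iff_kummer (hD : TheoremDAll) :
    NonKHToricArchLUKeyHenselDescent 3 3 4 ↔ NonKHToricArchLUKeyHenselDescentKummer 3 3 4 :=
  nonKHToricArchLUKeyHenselDescent_iff_kummer hD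

/-- The TRUE residual family of g17/g20 (`NonKHToricArchLU`) re-located (mod D): off the key-chain,
Hensel, descent and tame-Kummer cells. [folklore] -/
theorem nonKHToricArchLU_iff_kummer (hD : TheoremDAll) {e c n : ℕ} :
    NonKHToricArchLU e c n ↔ NonKHToricArchLUKeyHenselDescentKummer e c n :=
  nonKHToricArchLU_iff_descent.trans (nonKHToricArchLUKeyHenselDescent_iff_kummer hD)

/-- The new residual follows from the root outright (it is a WEAKER piece; hypothesis-free). [folklore] -/
theorem nonKHToricArchLUKeyHenselDescentKummer_of_root (hS : _root_.ResolutionOfSingularities)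
    (e c n : ℕ) : NonKHToricArchLUKeyHenselDescentKummer e c n :=
  nonKHToricArchLUKeyHenselDescentKummer_of_descent (nonKHToricArchLUKeyHenselDescent_of_root hS e c n)

/-- **`closes_kummer` — ROOT BY NAME (deciding theorem of this node).**  Cossart–Piltant floor (print) +
CJS-2020 (named fact) + the KK05 (NC)+(V) ascent Π₁ (print) + THEOREM D (typed, UNDECIDED) + the located
residual OFF THE KEY-CHAIN, HENSEL, DESCENT AND TAME-KUMMER CELLS in transcendence degree `≥ 4` + the
patching crux 0642 ⇒ `ResolutionOfSingularities`. [folklore] -/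
theorem closes_kummer (hCP : CossartPiltant2019LU3.{0}) (hCJS : CossartJannsenSaito2020Embedded.{0})
    (hAsc : KK05NCVAscent) (hD : TheoremDAll)
    (hN : ∀ d, 4 ≤ d → NonKHToricArchLUKeyHenselDescentKummer 3 3 d)
    (h₃ : Valuative.PatchingRel) : _root_.ResolutionOfSingularities :=
  closes_descent hCP hCJS hAsc
    (fun d hd => (nonKHToricArchLUKeyHenselDescent_iff_kummer hD).2 (hN d hd)) h₃

/-- ROOT BY NAME, hypothesis-free in THEOREM D: the g23 deciding theorem re-exported for this node's
residual family one level up (R23 ⇒ root), so that the node decides the root WITHOUT THEOREM D from the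
pieces it does not cut. [folklore] -/
theorem closes_descent_reexport (hCP : CossartPiltant2019LU3.{0})
    (hCJS : CossartJannsenSaito2020Embedded.{0}) (hAsc : KK05NCVAscent)
    (hN : ∀ d, 4 ≤ d → NonKHToricArchLUKeyHenselDescent 3 3 d) (h₃ : Valuative.PatchingRel) :
    _root_.ResolutionOfSingularities :=
  closes_descent hCP hCJS hAsc hN h₃

/-- Root-level summary: modulo floor + CJS + Π₁ + 0642 + THEOREM D the ROOT is EQUIVALENT to the residual
family off the four cells. [folklore] -/
theorem root_iff_kummer_sigma (hCP : CossartPiltant2019LU3.{0})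
    (hCJS : CossartJannsenSaito2020Embedded.{0}) (hAsc : KK05NCVAscent) (hD : TheoremDAll)
    (h₃ : Valuative.PatchingRel) :
    _root_.ResolutionOfSingularities ↔ ∀ d, 4 ≤ d → NonKHToricArchLUKeyHenselDescentKummer 3 3 d := by
  rw [root_iff_descent_sigma hCP hCJS hAsc h₃]
  exact forall₂_congr fun d _ => nonKHToricArchLUKeyHenselDescent_iff_kummer hD

end Cut

end Summit.ResolutionOfSingularities.ResolutionOfSingularities.Theorems.EigenLadderLU
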